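import Summits.QuantumFields.BalabanUV.T4Continuum.Support.VariationalCovariantTwoRunsNE3

/-!
# T⁴ programme, spine node NE2 (U1a), lane P2 — SUPPLIER ITEM (O2) «L-NE3», THE TWO-RUNS ADAPTER, file 3 (NON-VACUITY WITNESS):
# the constant-connection towers `R_k(y,μ) = e^{i a ∕ L^k}` inhabit the size class AND node U1b's `LocalRate (towReadings 𝒟) (2a²) L⁻¹`
# on the P2 readings (consistency differences of second order, `≤ 2a²∕L^k`, not required to vanish), and their straight-product coarsening
# is EXACT (`Π_L R_{k+1} = R_k`)

NE2 formalisation swarm `b2b-balaban-t4-ne2-formalise-*`, leaf prover 09 (gen 4); files 1–2 = `VariationalCovariantTwoRuns(NE3)`.  The point of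
this file is only that the adapter's displayed hypotheses (`LocalRate` on `towReadings`, size class `‖L^k·(R k − 1)‖ ≤ α`) are JOINTLY inhabited by
NON-FLAT data at the honest rate `θ = L⁻¹` — the abelian constant connection `a` sampled at spacing `L^{−k}` (the canonical pair's simplest
member) — so no hypothesis shape is contradictory or secretly forces flatness; and that for this family the NE3 part of the mismatch VANISHES
(`coarsen_constTower`), consistent with the adapter's bound.  It says nothing about Bałaban's minimisers.

HONEST FRAMING (T4-DAG p. 1).  Model level; elementary (`‖e^{ix} − 1‖ ≤ |x|`, `‖e^z − 1 − z‖ ≤ ‖z‖²` for `‖z‖ ≤ 1`, Mathlib); nothing printed is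
a hypothesis; no `def … : Prop`; no `sorry`; axioms standard.  NE3 OPEN; NE2 NOT proved; spine PROVED 0∕9; rung (B)+1 finite T⁴ — NOT infinite
volume, NOT a mass gap, NOT Clay.  HONEST DEPENDENCY (cell, verbatim): continuum YM on T⁴ ⇐ BetaPertH ∧ nine spine estimates (0/9 proved); BetaPertH ⇐
(D1) ∧ (D4) ∧ CAP+tail; G-an2-4 gates asym, D1 and NE2/3/4.
-/

noncomputable section

open scoped BigOperators ComplexConjugate

namespace Summit.QuantumFields.BalabanUV.T4Continuum.VariationalCovariantTwoRunsWitness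

open Finset
open Literature.MathematicalPhysics.QuantumFieldTheory.Balaban1983to89
open Literature.MathematicalPhysics.QuantumFieldTheory.Balaban1983to89.B5Prop11Plancherel (Tor fine unitVec)
open Literature.MathematicalPhysics.QuantumFieldTheory.Balaban1983to89.B5Block118 (bpt tstep)
open Literature.MathematicalPhysics.QuantumFieldTheory.Balaban1983to89.B5Composition116 (sites)
open Literature.MathematicalPhysics.QuantumFieldTheory.Balaban1983to89.T4EtaRateMin (Readings LocalRate)
open Summit.QuantumFields.BalabanUV.T4Continuum.VariationalCovariantFederbush (piT)
open Summit.QuantumFields.BalabanUV.T4Continuum.VariationalCovariantTwoRuns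
open Summit.QuantumFields.BalabanUV.T4Continuum.VariationalCovariantTwoRunsNE3

variable {d : ℕ} (L : ℕ) [NeZero L] (M : Fin d → ℕ) [hM : ∀ μ, NeZero (M μ)]

/-- the CONSTANT-CONNECTION TOWER: the abelian constant connection `a` sampled at spacing `L^{−k}`, `R_k(y,μ) = e^{i a ∕ L^k}` (data). [folklore] -/
def constTower (a : ℝ) : (k : ℕ) → Tor (fine (L ^ k) M) → Fin d → ℂ :=
  fun k _ _ => Complex.exp (Complex.I * (a / ((L ^ k : ℕ) : ℝ) : ℝ))

omit [NeZero L] hM in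
/-- `constTower` unfolds. [folklore] -/
theorem constTower_apply (a : ℝ) (k : ℕ) (y : Tor (fine (L ^ k) M)) (μ : Fin d) :
    constTower L M a k y μ = Complex.exp (Complex.I * (a / ((L ^ k : ℕ) : ℝ) : ℝ)) := rfl

/-- `0 < L^k` as a real. [folklore] -/
theorem lev_pos (k : ℕ) : (0 : ℝ) < ((L ^ k : ℕ) : ℝ) := by
  push_cast; exact pow_pos (Nat.cast_pos.mpr (Nat.pos_of_ne_zero (NeZero.ne L))) k

omit hM in
/-- THE SIZE CLASS: `‖L^k·(e^{ia∕L^k} − 1)‖ ≤ |a|`. [folklore] -/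
theorem size_constTower (a : ℝ) (k : ℕ) (y : Tor (fine (L ^ k) M)) (μ : Fin d) :
    ‖((L ^ k : ℕ) : ℂ) * (constTower L M a k y μ - 1)‖ ≤ |a| := by
  have hn := lev_pos L k
  rw [constTower_apply, norm_mul, Complex.norm_natCast]
  calc ((L ^ k : ℕ) : ℝ) * ‖Complex.exp (Complex.I * (a / ((L ^ k : ℕ) : ℝ) : ℝ)) - 1‖
      ≤ ((L ^ k : ℕ) : ℝ) * ‖(a / ((L ^ k : ℕ) : ℝ) : ℝ)‖ :=
        mul_le_mul_of_nonneg_left Real.norm_exp_I_mul_ofReal_sub_one_le hn.le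
    _ = |a| := by rw [Real.norm_eq_abs, abs_div, abs_of_pos hn]; field_simp

/-- the second-order reading: `‖L^k·(e^{ia∕L^k} − 1) − i a‖ ≤ a² ∕ L^k` for `|a| ≤ 1`. [folklore] -/
theorem norm_reading_sub_le (a : ℝ) (ha : |a| ≤ 1) (k : ℕ) :
    ‖((L ^ k : ℕ) : ℂ) * (Complex.exp (Complex.I * (a / ((L ^ k : ℕ) : ℝ) : ℝ)) - 1) - Complex.I * a‖ ≤ a ^ 2 / ((L ^ k : ℕ) : ℝ) := by
  have hn := lev_pos L k
  have hn1 : (1 : ℝ) ≤ ((L ^ k : ℕ) : ℝ) := by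
    push_cast; exact one_le_pow₀ (Nat.one_le_cast.mpr (Nat.one_le_iff_ne_zero.mpr (NeZero.ne L)))
  set z : ℂ := Complex.I * (a / ((L ^ k : ℕ) : ℝ) : ℝ) with hz
  have hzn : ‖z‖ = |a| / ((L ^ k : ℕ) : ℝ) := by
    rw [hz, norm_mul, Complex.norm_I, one_mul, Complex.norm_real, Real.norm_eq_abs, abs_div, abs_of_pos hn]
  have hz1 : ‖z‖ ≤ 1 := by
    rw [hzn]; exact (div_le_one hn).mpr (ha.trans hn1)
  have hLk : (L : ℂ) ^ k ≠ 0 := pow_ne_zero k (Nat.cast_ne_zero.mpr (NeZero.ne L))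
  have hz' : ((L ^ k : ℕ) : ℂ) * z = Complex.I * a := by
    calc ((L ^ k : ℕ) : ℂ) * z = Complex.I * a * ((L : ℂ) ^ k / (L : ℂ) ^ k) := by rw [hz]; push_cast; ring
      _ = Complex.I * a := by rw [div_self hLk, mul_one]
  have e : ((L ^ k : ℕ) : ℂ) * (Complex.exp z - 1) - Complex.I * a = ((L ^ k : ℕ) : ℂ) * (Complex.exp z - 1 - z) := by
    rw [← hz']; ring
  rw [e, norm_mul, Complex.norm_natCast]
  calc ((L ^ k : ℕ) : ℝ) * ‖Complex.exp z - 1 - z‖ ≤ ((L ^ k : ℕ) : ℝ) * ‖z‖ ^ 2 :=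
        mul_le_mul_of_nonneg_left (Complex.norm_exp_sub_one_sub_id_le hz1) hn.le
    _ = a ^ 2 / ((L ^ k : ℕ) : ℝ) := by rw [hzn, div_pow, sq_abs]; field_simp

omit hM in
/-- **`LocalRate` ON A NON-FLAT FAMILY**: the singleton class `{constTower a}` satisfies node U1b's shape on the P2 readings,
`LocalRate (towReadings {constTower a}) (2a²) L⁻¹`, for `|a| ≤ 1` (the consistency differences `L^{k+1}(e^{ia∕L^{k+1}} − 1) − L^k(e^{ia∕L^k} − 1)`
are second-order quantities bounded by `2a²∕L^k`; their non-vanishing for `a ≠ 0` is not kernel-checked here). [folklore] -/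
theorem localRate_constTower (a : ℝ) (ha : |a| ≤ 1) :
    LocalRate (towReadings L M {constTower L M a}) (2 * a ^ 2) ((L : ℝ)⁻¹) := by
  refine localRate_of_consistent L M fun R hR k y j μ => ?_
  rw [Set.mem_singleton_iff] at hR
  subst hR
  rw [constTower_apply, constTower_apply]
  have h1 := norm_reading_sub_le L a ha (k + 1)
  have h0 := norm_reading_sub_le L a ha k
  have hL1 : (1 : ℝ) ≤ L := Nat.one_le_cast.mpr (Nat.one_le_iff_ne_zero.mpr (NeZero.ne L))
  have hk : a ^ 2 / ((L ^ (k + 1) : ℕ) : ℝ) ≤ a ^ 2 / ((L ^ k : ℕ) : ℝ) := by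
    apply div_le_div_of_nonneg_left (sq_nonneg a) (lev_pos L k)
    push_cast; rw [pow_succ]; exact le_mul_of_one_le_right (pow_nonneg (by positivity) k) hL1
  calc _ ≤ ‖((L ^ (k + 1) : ℕ) : ℂ) * (Complex.exp (Complex.I * (a / ((L ^ (k + 1) : ℕ) : ℝ) : ℝ)) - 1) - Complex.I * a‖
          + ‖((L ^ k : ℕ) : ℂ) * (Complex.exp (Complex.I * (a / ((L ^ k : ℕ) : ℝ) : ℝ)) - 1) - Complex.I * a‖ := by
        rw [← norm_neg (((L ^ k : ℕ) : ℂ) * _ - _)]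
        refine le_trans (le_of_eq ?_) (norm_add_le _ _)
        congr 1; ring
    _ ≤ a ^ 2 / ((L ^ (k + 1) : ℕ) : ℝ) + a ^ 2 / ((L ^ k : ℕ) : ℝ) := add_le_add h1 h0
    _ ≤ 2 * (a ^ 2 / ((L ^ k : ℕ) : ℝ)) := by linarith
    _ = 2 * a ^ 2 * ((L : ℝ)⁻¹) ^ k := by rw [← inv_lev_eq L k]; ring

omit [NeZero L] hM in
/-- straight products of a constant phase: `Π_t c = c^t`. [folklore] -/
theorem piT_const {N : Fin d → ℕ} (c : ℂ) (x : Tor (fine L N)) (μ : Fin d) :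
    ∀ t : ℕ, piT L N (fun _ _ => c) x μ t = c ^ t
  | 0 => by simp [piT]
  | t + 1 => by rw [piT, piT_const c x μ t, pow_succ]

omit hM in
/-- **THE STRAIGHT-PRODUCT COARSENING IS EXACT on the constant family**: `Π_L e^{ia∕L^{k+1}} = e^{ia∕L^k}`, i.e.
`coarsen (fineOf (constTower a) k) = constTower a k` — the NE3 part of the two-runs mismatch vanishes identically here. [folklore] -/
theorem coarsen_constTower (a : ℝ) (k : ℕ) (y : Tor (fine (L ^ k) M)) (μ : Fin d) :
    coarsen L (fine (L ^ k) M) (fineOf L M (constTower L M a) k) y μ = constTower L M a k y μ := by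
  have hL : (L : ℂ) ≠ 0 := Nat.cast_ne_zero.mpr (NeZero.ne L)
  have hfine : fineOf L M (constTower L M a) k = fun _ _ => Complex.exp (Complex.I * (a / ((L ^ (k + 1) : ℕ) : ℝ) : ℝ)) := by
    funext x' ν; rfl
  rw [coarsen, hfine, piT_const, constTower_apply, ← Complex.exp_nat_mul]
  congr 1
  push_cast
  field_simp
  ring

/-- hence the adapter's conclusion holds trivially on this family (left side `0`), and the displayed hypotheses of
`VariationalCovariantTwoRunsNE3.lev_mul_norm_coarsen_sub_le_of_localRate_lev` are inhabited: the bound evaluates with `C = 2a²`, `θ = L⁻¹`,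
`α = |a|`. [folklore] -/
theorem adapter_on_constTower (hL : (1 : ℝ) ≤ L) (a : ℝ) (ha : |a| ≤ 1) (k : ℕ) (y : Tor (fine (L ^ k) M)) (μ : Fin d) :
    ((L ^ k : ℕ) : ℝ) * ‖coarsen L (fine (L ^ k) M) (fineOf L M (constTower L M a) k) y μ - constTower L M a k y μ‖
      ≤ (2 * (2 * a ^ 2) + |a| ^ 2 / 2 * Real.exp |a|) * ((L : ℝ)⁻¹) ^ k :=
  lev_mul_norm_coarsen_sub_le_of_localRate_lev L M (by positivity) (inv_nonneg.mpr (by positivity))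
    le_rfl (abs_nonneg a) (localRate_constTower L M a ha) (Set.mem_singleton _)
    (fun k x μ => size_constTower L M a k x μ) k y μ

end Summit.QuantumFields.BalabanUV.T4Continuum.VariationalCovariantTwoRunsWitness

end
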